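import Literature.AlgebraicGeometry.Resolution.OneDimAnalyticallyUnramified
import Mathlib.RingTheory.Flat.FaithfullyFlat.Algebra
import Mathlib.RingTheory.Ideal.MinimalPrime.Noetherian
import HarnessLib

/-!
# Analytically unramified one-dimensional local domains (Krull 1930; Kollár, Thm. 1.101), II

Topic: `Literature/AlgebraicGeometry/Resolution`. Sequel of `OneDimAnalyticallyUnramified.lean`:
the implication **(3) ⇒ (2)** of Kollár's Theorem 1.101 ([Kru30, Satz 7]) for a one-dimensional
Noetherian local domain `R` — if the `𝔪`-adic completion `R̂` is reduced then the normalization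
`R̄` is a finite `R`-module — and the assembled equivalence
`module_finite_integralClosure_iff_isReduced_adicCompletion` (Krull's criterion "finite
normalization ⇔ analytically unramified"), which discharges the named fact
`Literature.Barriers.ResolutionOfSingularities.QuasiExcellence.Krull1930_Kollar_1_101`.
Everything here is PROVED; no definitions, no named facts.

## Proof of (3) ⇒ (2) (conductor descent; not the printed one)

Kollár proves (3) ⇒ (2) for `R̂` by Nagata's theorem (Thm. 1.102) and descends to `R` through the
blow-up sequence (1). Here: let `S = R̂` (Noetherian, complete, local, `dim S = dim R = 1`,
faithfully flat over `R`) and `0 ≠ x ∈ 𝔪_R`. Nonzero elements of `R` are `S`-regular, hence lie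
in no minimal prime of `S`. For a minimal prime `𝔭`, `D = S/𝔭` is a complete one-dimensional
local domain, so `D̄` is finite (the tree's `module_finite_integralClosure_of_complete`, via
Cohen's structure theorem and Kiyek–Vicente II (3.18)) and some `x^N` conducts `D̄` into `D`
(`exists_pow_mul_mem_range_of_complete`). If `b = a/s ∈ R̄` then `aⁿ + Σ cᵢ aⁱ sⁿ⁻ⁱ = 0`, which
persists in `D`, so `ā/s̄ ∈ D̄` and `x^N a ∈ sS + 𝔭`. With `N` uniform over the finitely many
minimal primes, patching in the reduced ring `S` (`exists_notMem_minimalPrimes_forall_mul_mem`,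
`exists_pow_mem_span_of_notMem_minimalPrimes`) gives `x^{M+N} a ∈ sS ∩ R = sR` (faithful
flatness), i.e. `x^{M+N} R̄ ⊆ R`; thus `R̄ ≅ x^{M+N} R̄` is an `R`-submodule of `R·1`, finitely
generated as `R` is Noetherian.

## Sources

* J. Kollár, *Lectures on Resolution of Singularities*, Ann. of Math. Stud. 166, Princeton
  2007, §1.13, Thm. 1.101, Thm. 1.102 (PDF pp. 58–59 of the held copy). [Kollar2007]
-/

noncomputable section

open IsLocalRing Polynomial

namespace Literature.AlgebraicGeometry.Resolution

universe u

/-! ## `(3) ⇒ (2)`: a reduced completion forces finite normalization -/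

section Converse

variable (R : Type u) [CommRing R] [IsDomain R] [IsNoetherianRing R] [IsLocalRing R]

/-- **Kollár Thm. 1.101, (3) ⇒ (2), for local domains**: if the `𝔪`-adic completion `R̂` of a
one-dimensional Noetherian local domain `R` is reduced, then the normalization `R̄` of `R` is a
finite `R`-module. Proof (conductor descent, replacing the printed descent through the blow-up
sequence): for `0 ≠ x ∈ 𝔪` and each minimal prime `𝔭` of `R̂`, the complete local domain
`R̂/𝔭` has finite normalization (Nagata, Thm. 1.102), whence an `N` with
`x^N a ∈ s R̂ + 𝔭` whenever `a/s ∈ R̄`; patching over the finitely many minimal primes of the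
reduced ring `R̂` and faithful flatness of `R → R̂` give `x^{N'} R̄ ⊆ R`, so `R̄` embeds in `R`.
[cite: Kollar2007, Thm. 1.101 and Thm. 1.102] -/
theorem module_finite_integralClosure_of_isReduced_adicCompletion (hdim : ringKrullDim R = 1)
    [IsReduced (AdicCompletion (maximalIdeal R) R)] :
    Module.Finite R (integralClosure R (FractionRing R)) := by
  classical
  set S : Type u := AdicCompletion (maximalIdeal R) R with hS
  set W : Type u := ↥(integralClosure R (FractionRing R)) with hW
  haveI : IsNoetherianRing S := isNoetherianRing_adicCompletion_maximalIdeal R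
  haveI : Module.FaithfullyFlat R S := Module.FaithfullyFlat.of_flat_of_isLocalHom
  have hdimS : ringKrullDim S = 1 := (ringKrullDim_adicCompletion R).trans hdim
  -- a nonzero element of the maximal ideal
  have hnf : ¬ IsField R := (ringKrullDim_eq_one_iff_of_isLocalRing_isDomain.mp hdim).1
  obtain ⟨x, hxm, hx0⟩ : ∃ x ∈ maximalIdeal R, x ≠ 0 := by
    by_contra! h
    exact hnf (IsLocalRing.isField_iff_maximalIdeal_eq.mpr ((Submodule.eq_bot_iff _).mpr h))
  have hxS : algebraMap R S x ∈ maximalIdeal S := map_nonunit (algebraMap R S) x hxm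
  -- nonzero elements of `R` stay outside the minimal primes of `S` (flatness)
  have hnotmin : ∀ r : R, r ≠ 0 → ∀ p ∈ minimalPrimes S, algebraMap R S r ∉ p := by
    intro r hr p hp hmem
    have h1 : IsSMulRegular S (algebraMap R S r) :=
      ((IsRegular.of_ne_zero hr).left.isSMulRegular).of_flat
    have hL : IsLeftRegular (algebraMap R S r) := isLeftRegular_iff.mpr h1
    have hR : IsRegular (algebraMap R S r) := ⟨hL, hL.right_of_commute fun b => Commute.all _ _⟩
    exact notMem_nonZeroDivisors_of_mem_mem_minimalPrimes hmem hp hR.mem_nonZeroDivisors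
  have hfinmin : (minimalPrimes S).Finite := minimalPrimes.finite_of_isNoetherianRing S
  -- per minimal prime: a conductor exponent
  have hloc : ∀ p ∈ minimalPrimes S, ∃ N : ℕ, ∀ (a s : R) (n : ℕ) (c : ℕ → R), s ≠ 0 →
      a ^ n + ∑ i ∈ Finset.range n, c i * a ^ i * s ^ (n - i) = 0 →
        algebraMap R S (x ^ N * a) ∈ Ideal.span {algebraMap R S s} ⊔ p := by
    intro p hp
    haveI hpprime : p.IsPrime := IsMinimalPrime.isPrime hp
    haveI : Nontrivial (S ⧸ p) := Ideal.Quotient.nontrivial_iff.mpr hpprime.ne_top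
    haveI : IsLocalRing (S ⧸ p) :=
      IsLocalRing.of_surjective' (Ideal.Quotient.mk p) Ideal.Quotient.mk_surjective
    haveI : IsLocalHom (Ideal.Quotient.mk p) :=
      IsLocalHom.of_surjective _ Ideal.Quotient.mk_surjective
    haveI : IsAdicComplete (maximalIdeal (S ⧸ p)) (S ⧸ p) := by
      have h := isAdicComplete_map_of_finite S (S ⧸ p) (maximalIdeal S)
      rwa [Ideal.Quotient.algebraMap_eq, ← maximalIdeal_quotient_eq_map] at h
    -- the image of `x` is a nonzero element of the maximal ideal, so `dim S/p = 1`
    set y : S ⧸ p := Ideal.Quotient.mk p (algebraMap R S x) with hy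
    have hym : y ∈ maximalIdeal (S ⧸ p) := map_nonunit (Ideal.Quotient.mk p) _ hxS
    have hy0 : y ≠ 0 := by
      rw [hy, Ne, Ideal.Quotient.eq_zero_iff_mem]
      exact hnotmin x hx0 p hp
    have hdimD : ringKrullDim (S ⧸ p) = 1 := by
      refine le_antisymm ((ringKrullDim_quotient_le p).trans hdimS.le) ?_
      have hnot : ¬ ringKrullDim (S ⧸ p) ≤ 0 := fun h0 => by
        haveI : Ring.KrullDimLE 0 (S ⧸ p) := Ring.krullDimLE_iff.mpr h0
        have hF : IsField (S ⧸ p) := Ring.KrullDimLE.isField_of_isDomain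
        rw [IsLocalRing.isField_iff_maximalIdeal_eq] at hF
        rw [hF, Ideal.mem_bot] at hym
        exact hy0 hym
      exact Order.succ_le_of_lt (lt_of_not_ge hnot)
    obtain ⟨N, hN⟩ := exists_pow_mul_mem_range_of_complete (S ⧸ p) hdimD hym
    refine ⟨N, fun a s n c hs hrel => ?_⟩
    set π : R →+* S ⧸ p := (Ideal.Quotient.mk p).comp (algebraMap R S) with hπ
    have hrelD : π a ^ n + ∑ i ∈ Finset.range n, π (c i) * π a ^ i * π s ^ (n - i) = 0 := by
      have := congrArg π hrel
      simpa only [map_add, map_pow, map_sum, map_mul, map_zero] using this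
    have hsD : π s ≠ 0 := by
      rw [hπ, RingHom.comp_apply, Ne, Ideal.Quotient.eq_zero_iff_mem]
      exact hnotmin s hs p hp
    set K := FractionRing (S ⧸ p)
    have hsK : algebraMap (S ⧸ p) K (π s) ≠ 0 :=
      (map_ne_zero_iff _ (IsFractionRing.injective (S ⧸ p) K)).mpr hsD
    have hint : IsIntegral (S ⧸ p) (algebraMap (S ⧸ p) K (π a) / algebraMap (S ⧸ p) K (π s)) :=
      isIntegral_div_of_homogeneous_rel hsK hrelD
    obtain ⟨d, hd⟩ := hN ⟨_, hint⟩
    -- clear denominators: `y^N · π a = d · π s`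
    have hD : y ^ N * π a = d * π s := by
      apply IsFractionRing.injective (S ⧸ p) K
      have h1 : algebraMap (S ⧸ p) K (y ^ N) *
          (algebraMap (S ⧸ p) K (π a) / algebraMap (S ⧸ p) K (π s)) =
          algebraMap (S ⧸ p) K d := by
        have := congrArg Subtype.val hd
        simpa using this
      rw [map_mul, map_mul, ← h1, mul_assoc, div_mul_cancel₀ _ hsK]
    obtain ⟨d', rfl⟩ := Ideal.Quotient.mk_surjective d
    have hmem : algebraMap R S (x ^ N * a) - d' * algebraMap R S s ∈ p := by
      rw [← Ideal.Quotient.eq]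
      simpa only [hy, hπ, RingHom.comp_apply, map_mul, map_pow] using hD
    refine Submodule.mem_sup.mpr ⟨d' * algebraMap R S s,
      Ideal.mul_mem_left _ _ (Ideal.mem_span_singleton_self _), _, hmem, ?_⟩
    ring
  choose! Nf hNf using hloc
  set N₀ : ℕ := hfinmin.toFinset.sup Nf with hN₀
  -- patching element and its power of `x`
  obtain ⟨e, he_notMem, he⟩ := exists_notMem_minimalPrimes_forall_mul_mem S hfinmin
  obtain ⟨M, hM⟩ := exists_pow_mem_span_of_notMem_minimalPrimes S hdimS.le he_notMem hxS
  obtain ⟨u, hu⟩ := Ideal.mem_span_singleton'.mp hM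
  -- `x^(M+N₀) · R̄ ⊆ R`
  have key : ∀ w : W, ∃ t : R, algebraMap R W (x ^ (M + N₀)) * w = algebraMap R W t := by
    intro w
    obtain ⟨a, s, hs0', hws⟩ := exists_mul_algebraMap_eq_of_mem_integralClosure R w
    have hs0 : s ≠ 0 := fun h => hs0' (by rw [h, map_zero])
    obtain ⟨n, c, hrel⟩ := exists_homogeneous_rel_of_isIntegral (K := FractionRing R)
      (IsFractionRing.injective R (FractionRing R)) w.2 (a := a) (s := s)
      (by have := congrArg Subtype.val hws; simpa using this)
    have hall : ∀ p ∈ minimalPrimes S,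
        algebraMap R S (x ^ N₀ * a) ∈ Ideal.span {algebraMap R S s} ⊔ p := by
      intro p hp
      have h1 := hNf p hp a s n c hs0 hrel
      have hle : Nf p ≤ N₀ := Finset.le_sup (f := Nf) (hfinmin.mem_toFinset.mpr hp)
      have hxa : x ^ N₀ * a = x ^ (N₀ - Nf p) * (x ^ Nf p * a) := by
        rw [← mul_assoc, ← pow_add, Nat.sub_add_cancel hle]
      rw [hxa, map_mul]
      exact Ideal.mul_mem_left _ _ h1
    have h2 : e * algebraMap R S (x ^ N₀ * a) ∈ Ideal.span {algebraMap R S s} := he _ _ hall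
    have h3 : algebraMap R S (x ^ (M + N₀) * a) ∈ Ideal.span {algebraMap R S s} := by
      have : algebraMap R S (x ^ (M + N₀) * a) = u * (e * algebraMap R S (x ^ N₀ * a)) := by
        rw [pow_add, mul_assoc, map_mul, map_pow, ← hu]
        ring
      rw [this]
      exact Ideal.mul_mem_left _ _ h2
    -- faithfully flat descent
    have h4 : x ^ (M + N₀) * a ∈ Ideal.span ({s} : Set R) := by
      rw [← Ideal.comap_map_eq_self_of_faithfullyFlat (B := S) (Ideal.span ({s} : Set R)),
        Ideal.mem_comap, Ideal.map_span, Set.image_singleton]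
      exact h3
    obtain ⟨t, ht⟩ := Ideal.mem_span_singleton'.mp h4
    refine ⟨t, mul_right_cancel₀ hs0' ?_⟩
    rw [mul_assoc, hws, ← map_mul, ← map_mul, ← ht]
  -- conclude: `R̄ ≅ x^k R̄ ⊆ R·1`, a Noetherian `R`-module
  have hinjW : Function.Injective (algebraMap R W) := fun a b h => by
    have := congrArg (fun z : W => (z : FractionRing R)) h
    exact IsFractionRing.injective R (FractionRing R) this
  have hxk : algebraMap R W (x ^ (M + N₀)) ≠ 0 :=
    (map_ne_zero_iff _ hinjW).mpr (pow_ne_zero _ hx0)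
  set ψ : W →ₗ[R] W := LinearMap.mulLeft R (algebraMap R W (x ^ (M + N₀))) with hψ
  have hψinj : Function.Injective ψ := mul_right_injective₀ hxk
  have hrange : LinearMap.range ψ ≤ LinearMap.range (Algebra.linearMap R W) := by
    rintro _ ⟨w, rfl⟩
    obtain ⟨t, ht⟩ := key w
    exact ⟨t, ht.symm⟩
  haveI : IsNoetherian R (LinearMap.range (Algebra.linearMap R W)) :=
    isNoetherian_of_surjective (Algebra.linearMap R W).rangeRestrict
      (LinearMap.range_rangeRestrict _)
  haveI : IsNoetherian R (LinearMap.range ψ) := isNoetherian_of_le hrange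
  haveI : Module.Finite R (LinearMap.range ψ) := Module.IsNoetherian.finite R _
  exact Module.Finite.equiv (LinearEquiv.ofInjective ψ hψinj).symm

end Converse

/-! ## Krull's criterion -/

/-- **Krull's criterion (Kollár Thm. 1.101 (2) ⇔ (3); [Kru30, Satz 7]) for one-dimensional
Noetherian local domains**: the normalization `R̄` is a finite `R`-module iff the `𝔪`-adic
completion `R̂` is reduced (`R` is "analytically unramified"). This is exactly the statement
vendored as the named fact
`Literature.Barriers.ResolutionOfSingularities.QuasiExcellence.Krull1930_Kollar_1_101`, which it
discharges (see `QuasiExcellenceNecessaryProofs.lean`). [cite: Kollar2007, Thm. 1.101] -/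
theorem module_finite_integralClosure_iff_isReduced_adicCompletion (R : Type u) [CommRing R]
    [IsDomain R] [IsNoetherianRing R] [IsLocalRing R] (hdim : ringKrullDim R = 1) :
    Module.Finite R (integralClosure R (FractionRing R)) ↔
      IsReduced (AdicCompletion (maximalIdeal R) R) :=
  ⟨fun _ => isReduced_adicCompletion_of_finite_integralClosure R hdim.le,
    fun _ => module_finite_integralClosure_of_isReduced_adicCompletion R hdim⟩

end Literature.AlgebraicGeometry.Resolution

end
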